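import Literature.IUT.HodgeArakelov.EtaleThetaDataOfSettingRootHypOfCor28iIntrinsicInner

/-!
# G-w5d169-2, ROUTE 2 companion-free: the binder «`Γ` induces an automorphism of `Δ_Θ`» IN SUBGROUP-STABILITY CURRENCY

S. Mochizuki, *The étale theta function …*, Publ. RIMS **45** (2009) [EtTh] (refereed), Cor. 2.8 (i) p. 42, proof
l. 3–5: "since `Δ_Θ ⊆ (Δ^tp_X)^Θ` may be characterized as a subquotient of `Π^tp_C` … `γ` induces an automorphism of
`Δ_Θ`"; Def. 2.7 p. 41 [cite: MochizukiEtTh2009, Cor 2.8(i) p.42].  [IUTchII] Prop. 1.4 p. 27 / Prop. 3.4 (i) p. 91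
(claim key `Mochizuki2012`, DISPUTED, D-0012) [cite: Mochizuki2012, Prop 1.4 p.27].

abc-iut cell (block C / W6 seat abc-iut-w6-d051 gen 4; GAP-LEDGER row **G-w5d169-2**).  PROOF-ONLY (0 def, no instance,
no named fact).  The companion-free closers `rootHyp_of_cor28_i_intrinsic(_innerAdjust)` (p445736 / p446492) and the node
knit p447525 carry the binder `hInd : ∀ tower-stabilising Γ, ∃ Γ_Θ, InducesOnTheta Γ Γ_Θ`.  HERE that binder is put in
the same currency as the Prop 2.4 tower clauses — stability of two subgroups of `Π^tp_C`:
* (generic, any orbit datum `O`) **`ThetaOrbitData.exists_inducesOnTheta_of_map_eq`** — `Γ(top) = top ∧ Γ(bot) = bot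
  ⇒ ∃ Γ_Θ, InducesOnTheta Γ Γ_Θ` (`QuotientGroup.congr`); with abc-iut-f-152's `InducesOnTheta.unique` and the converse
  `InducesOnTheta.map_top_eq` / `map_bot_eq` below, «`γ` induces an automorphism of the subquotient `Δ_Θ = top/bot`» is
  EQUIVALENT to the two stability clauses (`inducesOnTheta_iff_map_eq`);
* **`rootHyp_of_cor28_i_intrinsic_stable`** — the v2 package with `hInd` REPLACED by
  `hΘ : ∀ tower-stabilising Γ, Γ(ι(toTheta⁻¹Δ_Θ)) = ι(toTheta⁻¹Δ_Θ) ∧ Γ(ι(Ker toTheta)) = ι(Ker toTheta)` (the cyclotome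
  data `top`/`bot` of `ofEmbedding`); node-level consumers obtain the `hInd` of p447525 as
  `fun Γ h => (ofEmbedding ε hC hS).exists_inducesOnTheta_of_map_eq (hΘ Γ h).1 (hΘ Γ h).2`.
Nothing of [IUTchII] asserted; no side taken on [IUTchIII] Cor. 3.12; typed ≠ proved.
-/

noncomputable section

open Topology

namespace Literature.AnabelianGeometry.EtaleTheta.ThetaCovers.ThetaOrbitData

universe u

variable {l : ℕ} {T : TemperedCoverData.{u} l} (O : ThetaOrbitData T)

/-- An induced automorphism of `Δ_Θ` forces `Γ(top) = top` (part of the definition). [cite: MochizukiEtTh2009, Cor 2.8(i) p.42] -/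
theorem InducesOnTheta.map_top_eq {Γ : T.Gtp ≃ₜ* T.Gtp} {ΓΘ : O.DeltaTheta ≃* O.DeltaTheta}
    (h : O.InducesOnTheta Γ ΓΘ) : O.top.map Γ.toMulEquiv.toMonoidHom = O.top :=
  h.1

/-- An induced automorphism of `Δ_Θ = top/bot` forces `Γ(bot) = bot` (`Γ t ∈ bot ⟺ Γ_Θ [t] = 1 ⟺ [t] = 1`).
[cite: MochizukiEtTh2009, Cor 2.8(i) p.42] -/
theorem InducesOnTheta.map_bot_eq {Γ : T.Gtp ≃ₜ* T.Gtp} {ΓΘ : O.DeltaTheta ≃* O.DeltaTheta}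
    (h : O.InducesOnTheta Γ ΓΘ) : O.bot.map Γ.toMulEquiv.toMonoidHom = O.bot := by
  obtain ⟨hΓ, hind⟩ := h
  have key : ∀ t : ↥O.top, (t : T.Gtp) ∈ O.bot ↔ Γ t ∈ O.bot := fun t => by
    have h1 : ((QuotientGroup.mk t : O.DeltaTheta) = 1) ↔ (t : T.Gtp) ∈ O.bot := by
      rw [QuotientGroup.eq_one_iff, Subgroup.mem_subgroupOf]
    have h2 : (ΓΘ (QuotientGroup.mk t) = 1) ↔ Γ t ∈ O.bot := by
      rw [hind, QuotientGroup.eq_one_iff, Subgroup.mem_subgroupOf]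
    rw [← h1, ← h2, MulEquiv.map_eq_one_iff]
  ext g
  constructor
  · rintro ⟨b, hb, rfl⟩
    exact (key ⟨b, O.bot_le hb⟩).mp hb
  · intro hg
    obtain ⟨t, ht, htg⟩ := hΓ.ge (O.bot_le hg)
    refine ⟨t, (key ⟨t, ht⟩).mpr ?_, htg⟩
    show Γ t ∈ O.bot
    rw [show Γ t = g from htg]
    exact hg

/-- **`Γ(top) = top ∧ Γ(bot) = bot ⇒ Γ` induces an automorphism of `Δ_Θ = top/bot`** (the quotient of the restriction
of `Γ` to `top`, `QuotientGroup.congr`). [cite: MochizukiEtTh2009, Cor 2.8(i) p.42] -/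
theorem exists_inducesOnTheta_of_map_eq {Γ : T.Gtp ≃ₜ* T.Gtp}
    (htop : O.top.map Γ.toMulEquiv.toMonoidHom = O.top) (hbot : O.bot.map Γ.toMulEquiv.toMonoidHom = O.bot) :
    ∃ ΓΘ : O.DeltaTheta ≃* O.DeltaTheta, O.InducesOnTheta Γ ΓΘ := by
  let e : ↥O.top ≃* ↥O.top := (Γ.toMulEquiv.subgroupMap O.top).trans (MulEquiv.subgroupCongr htop)
  have he : ∀ t : ↥O.top, ((e t : ↥O.top) : T.Gtp) = Γ t := fun t => rfl
  have hsymm : ∀ t : ↥O.top, ((e.symm t : ↥O.top) : T.Gtp) = Γ.symm t := fun t => by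
    have h1 : Γ ((e.symm t : ↥O.top) : T.Gtp) = t := by rw [← he, MulEquiv.apply_symm_apply]
    rw [← h1, ContinuousMulEquiv.symm_apply_apply]
  have hN : (O.bot.subgroupOf O.top).map (e : ↥O.top →* ↥O.top) = O.bot.subgroupOf O.top := by
    ext t
    constructor
    · rintro ⟨s, hs, rfl⟩
      have hs' : (s : T.Gtp) ∈ O.bot := Subgroup.mem_subgroupOf.mp hs
      show ((e s : ↥O.top) : T.Gtp) ∈ O.bot
      rw [he]
      exact hbot.le ⟨s, hs', rfl⟩
    · intro ht
      have ht' : (t : T.Gtp) ∈ O.bot := Subgroup.mem_subgroupOf.mp ht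
      refine ⟨e.symm t, ?_, e.apply_symm_apply t⟩
      show e.symm t ∈ O.bot.subgroupOf O.top
      rw [Subgroup.mem_subgroupOf, hsymm]
      exact (map_symm_eq O.bot hbot).le ⟨t, ht', rfl⟩
  refine ⟨QuotientGroup.congr _ _ e hN, htop, fun d => ?_⟩
  rw [QuotientGroup.congr_mk]
  exact congrArg QuotientGroup.mk (Subtype.ext (he d))

/-- **«`γ` induces an automorphism of `Δ_Θ`» ⟺ `Γ(top) = top ∧ Γ(bot) = bot`.** [cite: MochizukiEtTh2009, Cor 2.8(i) p.42] -/
theorem inducesOnTheta_iff_map_eq (Γ : T.Gtp ≃ₜ* T.Gtp) :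
    (∃ ΓΘ : O.DeltaTheta ≃* O.DeltaTheta, O.InducesOnTheta Γ ΓΘ) ↔
      O.top.map Γ.toMulEquiv.toMonoidHom = O.top ∧ O.bot.map Γ.toMulEquiv.toMonoidHom = O.bot :=
  ⟨fun ⟨_, h⟩ => ⟨h.map_top_eq, h.map_bot_eq⟩, fun h => O.exists_inducesOnTheta_of_map_eq h.1 h.2⟩

end Literature.AnabelianGeometry.EtaleTheta.ThetaCovers.ThetaOrbitData

namespace Literature.IUT.HodgeArakelov

namespace EtaleThetaDataOfSetting

open Literature.AnabelianGeometry.EtaleTheta ThetaCovers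
open Literature.AnabelianGeometry.EtaleTheta CohomologySystemOfContH1

universe u

variable {p : ℕ} [Fact p.Prime] {D : Literature.AnabelianGeometry.EtaleTheta.ThetaSetting p}
  {E : D.EtaleThetaData} {l : ℕ} (C : E.DoubleUnderline l) (hq : IsQuotientMap D.toTheta)
  (α : (Pi C) ≃ₜ* (Pi C)) {T : TemperedCoverData.{u} l} (ε : C.OrbitEmbedding T)

/-- **G-w5d169-2 ALONG ROUTE 2, COMPANION-FREE, `InducesOnTheta` in subgroup-stability currency**: as
`rootHyp_of_cor28_i_intrinsic_innerAdjust` (p446492), with `hInd` REPLACED by `hΘ` — every tower-stabilising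
`Γ ∈ Aut_top(Π^tp_C)` stabilises the two subgroups `ι(toTheta⁻¹ Δ_Θ)` (`ε.top`) and `ι(Ker toTheta)` (`ε.bot`) of `Π^tp_C`
whose quotient is the cyclotome of `ofEmbedding ε hC hS` ("`Δ_Θ` … a characteristic subquotient", Cor 2.8 (i) p.42).
Residual BY NAME: {F-0609 `h24`, F-0640 `h28`, `hstd`, `hDtau'` (inner-adjusted), `hΘ`, `IsOpenEmbedding ι`, `hq`}.
[cite: MochizukiEtTh2009, Cor 2.8(i) p.42] -/
theorem rootHyp_of_cor28_i_intrinsic_stable [(PiYdd C).Normal] [hN : D.GtpYdd.Normal] {N : ℕ+}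
    (μ : D.CyclotomeMod l N) (hC : D.Compat) (hS : D.Sec2Hyps) (h15 : D.Prop15iii E hC) (L : C.CuspLabels)
    (R : RigidData.{0} N l) (hR : R = C.rigidData μ hC hS h15 L) (h218i : R.Cor218_i)
    (hιe : IsOpenEmbedding ε.ι) (h24 : T.Prop24)
    (hstd : (ThetaOrbitData.ofEmbedding ε hC hS).IsStandard) (h28 : (ThetaOrbitData.ofEmbedding ε hC hS).Cor28_i)
    (hDtau' : ∀ Γ : T.Gtp ≃ₜ* T.Gtp, (∀ S ∈ T.tower, S.map Γ.toMulEquiv.toMonoidHom = S) →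
      ∃ u ∈ C.Huu, ∀ Dt ∈ (ThetaOrbitData.ofEmbedding ε hC hS).Dtau,
        Dt.map (Γ.trans (ThetaOrbitData.innerAutTop (ε.ι u))).toMulEquiv.toMonoidHom ∈
          (ThetaOrbitData.ofEmbedding ε hC hS).Dtau)
    (hΘ : ∀ Γ : T.Gtp ≃ₜ* T.Gtp, (∀ S ∈ T.tower, S.map Γ.toMulEquiv.toMonoidHom = S) →
      ε.top.map Γ.toMulEquiv.toMonoidHom = ε.top ∧ ε.bot.map Γ.toMulEquiv.toMonoidHom = ε.bot) :
    ∃ τ : Pi C, ∃ ε' : (coh C).H1 ⊤, l • ε' = 0 ∧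
      autActTopOfCor218i C hq μ hC hS h15 L R hR h218i α (rootTop C) =
        h1TopConjEquiv (phi C) (D.lDeltaTheta l) (PiYdd C) τ (rootTop C) + ε' :=
  rootHyp_of_cor28_i_intrinsic_innerAdjust C hq α ε μ hC hS h15 L R hR h218i hιe h24 hstd h28 hDtau'
    fun Γ hΓ => (ThetaOrbitData.ofEmbedding ε hC hS).exists_inducesOnTheta_of_map_eq (hΘ Γ hΓ).1 (hΘ Γ hΓ).2

end EtaleThetaDataOfSetting

end Literature.IUT.HodgeArakelov

end
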